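import Summits.HodgeConjecture.HodgeConjecture.Theorems.F0LD1ThetaArchCompactStepNeg
import Literature.NumberTheory.Weil1964.ArchPlaceFockRotationCoefficient
import Literature.NumberTheory.GelbartRogawski1991.ArchLocalUnitarySurjective
import Summits.HodgeConjecture.HodgeConjecture.Theorems.F0LD2PinnedArchSingleTransport
import Literature.NumberTheory.Automorphic.AutomorphicSpectrumProofs
import HarnessLib

-- statements over the theta-kernel datum elaborate to very large types; elaborate sequentially (as in the ★ kit lineage)
set_option Elab.async false

/-!
# (Gα-C∞, plate (P2c)) DEFINITE-PLACE TRANSITIVITY of the archimedean ladder: at a real place where the pair form has CONSTANT sign, two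
# Folland–Hermite indices with the same exponents off two coordinates of that place and the same degree on them have theta classes in the
# SAME closed invariant subspaces (line LD1 of crux HLiu418, brick (Gα-C∞) `ArchLadder`, LD1-plan (g2) DEALS #9-bis; owner A-p16 (g35))

Cell hodgecm-mathlib, floor 0; namespace `Summit.HodgeConjecture.HodgeConjecture.Cruxes.HLiu418.F0LD1ThetaArchDefiniteTransitivity`;
`--supports stmt-HodgeConjecture-24832 --as helper`.  THEOREMS ONLY (no definition, no instance, no notation, no `sorry`).

**`thetaClass_follandHermite_mem_of_sameDegree_of_constSign`** — the hypothesis `hdef` of ★ (P5-comb) `F0LD1ArchLadderReachability.reach_of_sameType_two` for the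
predicate `P β := [θ_{h_β ⊗ Φ_f}] ∈ Q`: let `v₀` be a real place of `L⁺` at which the sign vector `x_{v₀}` is constant (`hconst`: all `> 0` or all `≤ 0`; every
place where `dV` is definite), `kp ≠ km` two coordinates, `Q ⊆ L²([U(H)], ν)` closed and `R`-invariant, and `β, γ` Folland–Hermite indices that agree off
`{(kp,v₀), (km,v₀)}` with `γ(kp,v₀) + γ(km,v₀) = β(kp,v₀) + β(km,v₀)`.  Then `[θ_{h_β ⊗ Φ_f}] ∈ Q → [θ_{h_γ ⊗ Φ_f}] ∈ Q`.
PROOF = TWO compact steps through `m := merge (kp,v₀) (km,v₀) β = merge … γ` (★ `merge_eq_merge`) with ONE element `u ∈ U(σ_{w₀} diag dV)(ℂ)` whose phase matrix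
is the rational mixing `mixU` of the two coordinates (★ S1 `GRConstruction.exists_archLocal_entries_eq_of_pos ∕ _of_neg`, M = 1), read in `U(H)(𝔸)` through the
pin (★ `F0LD2PinnedArchSingleTransport.exists_archLocal_pin_adelicSingle_eq`): both target Hermite coefficients are non-zero (★ `ArchPlaceFockRotationCoefficient`),
so ★ (P1) `F0LD1ThetaArchCompactStep.thetaClass_follandHermite_mem_of_uKernel_ne_zero` (positive sign) ∕ ★ (P1⁻) `…_of_neg` (negative sign) apply twice; the
full-torus projectors come from ★ `F0LD1ArchTorusHom.exists_continuous_archTorusHom`, ★ `exists_borel_haarProbability`, ★ `exists_charRep_prod_prod_zpow`, with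
orbit continuity ∕ unitarity of `R|_{T_∞}` from ★ `isStronglyContinuous_rightRegular_holds` ∕ `isUnitary_rightRegular` (as in ★ `torusProjector`).
Nothing printed is discharged; HC_CM is proved only modulo the 7 printed citations (2 remaining: hLiu418 = stmt-HodgeConjecture-24832, h413 =
stmt-HodgeConjecture-24833) until rung 0 closes; count-neutral.

References (prose locators): Folland 1989 §1.7, Prop. (4.39), Ch. 4 §5; Kashiwara–Vergne 1978 §6; Howe 1989 §3; Konno–Konno 2007 Thm. 5.4;
Bröcker–tom Dieck 1985 III (5.10); Borel–Jacquet 1979 §4.1, §4.6.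
-/

set_option autoImplicit false
set_option linter.dupNamespace false

noncomputable section

open NumberField NumberField.InfinitePlace MeasureTheory IsDedekindDomain
open scoped Matrix ComplexOrder ENNReal TensorProduct SchwartzMap Kronecker Classical ComplexConjugate InnerProductSpace

namespace Summit.HodgeConjecture.HodgeConjecture.Cruxes.HLiu418.F0LD1ThetaArchDefiniteTransitivity

open _root_.MeasureTheory
open Literature.NumberTheory.Automorphic Literature.NumberTheory.Automorphic.UnitaryGroup
open Literature.NumberTheory.Automorphic.UnitaryGroup.CotangentForms
open Literature.NumberTheory.Automorphic.IdeleClassGroup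
open Literature.NumberTheory.Automorphic.Liu2021
open Literature.NumberTheory.Automorphic.Liu2021.Def411WeilCarriers
open Literature.NumberTheory.Automorphic.Liu2021.Def411WeilCarriersDoubling
open Literature.NumberTheory.Automorphic.Liu2021.CinfThetaTorus
open Literature.NumberTheory.GelbartRogawski1991 Literature.NumberTheory.GelbartRogawski1991.UnitaryDualPair
open Literature.NumberTheory.GelbartRogawski1991.GRConstruction
open Literature.NumberTheory.Weil1964
open Literature.RepresentationTheory.Liu2021
open Literature.RepresentationTheory.HeisenbergGroup Literature.Analysis.SegalBargmann
open Literature.RepresentationTheory.KonnoKonno2007 Literature.RepresentationTheory.KonnoKonno2007.RealDualPair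
open Literature.RepresentationTheory.CompactGroups
open Summit.HodgeConjecture.HodgeConjecture.Cruxes.HLiu418.F0LD1ThetaTransportKit
open Summit.HodgeConjecture.HodgeConjecture.Cruxes.HLiu418.F0LD2ThetaTensorClasses
open Summit.HodgeConjecture.HodgeConjecture.Cruxes.HLiu418.F0LD1ArchTorusHom
open Summit.HodgeConjecture.HodgeConjecture.Cruxes.HLiu418.F0LD1ThetaClassTorusExtraction
open Summit.HodgeConjecture.HodgeConjecture.Cruxes.HLiu418.F0LD1ThetaSliceTorusProjector (exists_charRep_prod_prod_zpow)
open Summit.HodgeConjecture.HodgeConjecture.Cruxes.HLiu418.F0LD2PinnedArchSingleTransport (exists_archLocal_pin_adelicSingle_eq)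
open Summit.HodgeConjecture.HodgeConjecture.Cruxes.HLiu418.F0LD1ThetaArchCompactStep
open Summit.HodgeConjecture.HodgeConjecture.Cruxes.HLiu418.F0LD1ThetaArchCompactStepNeg

section Transitivity



variable (L : Type) [Field L] [NumberField L] [IsCMField L] (N : ℕ) (H : Matrix (Fin N) (Fin N) L)
  {n' : ℕ} (e₁ : Fin N × Fin 1 ≃ Fin n') (dV : Fin N → L) (hdV : ∀ i, IsCMField.complexConj L (dV i) = dV i)
  (hdV0 : ∀ i, dV i ≠ 0)
  (ιA : (adelicGroupData (↥(maximalRealSubfield L)) L (IsCMField.complexConj L) N H).Adelic →*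
    ↥(UnitaryGroup.adelic (↥(maximalRealSubfield L)) L (IsCMField.complexConj L) N (Matrix.diagonal dV)))
  (hιA : Continuous ιA ∧ ∀ ⦃γ : (adelicGroupData (↥(maximalRealSubfield L)) L (IsCMField.complexConj L) N H).Adelic⦄,
    γ ∈ (UnitaryGroup.toAdelic (↥(maximalRealSubfield L)) L (IsCMField.complexConj L) N H).range →
      ιA γ ∈ (UnitaryGroup.toAdelic (↥(maximalRealSubfield L)) L (IsCMField.complexConj L) N (Matrix.diagonal dV)).range)
  (μ : Literature.NumberTheory.Automorphic.IdeleClassGroup L →ₜ* Circle) (hμ : IsConjugateSymplectic L μ) (a : (↥(maximalRealSubfield L))ˣ)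
  (hρ : HasThetaMajorants fun
      (p : ↥(UnitaryGroup.adelic (↥(maximalRealSubfield L)) L (IsCMField.complexConj L) N (Matrix.diagonal dV)) ×
        ↥(UnitaryGroup.adelic (↥(maximalRealSubfield L)) L (IsCMField.complexConj L) 1 (JW (↥(maximalRealSubfield L)) L a)))
      (Φ : piSchwartzBruhat (↥(maximalRealSubfield L)) (Fin n')) =>
        pairRep (↥(maximalRealSubfield L)) L (IsCMField.complexConj L) N 1 e₁ (Matrix.diagonal dV) (JW (↥(maximalRealSubfield L)) L a)
          (chiSplittingLine L e₁ dV hdV hdV0 (toHeckeCharacter L μ) (isUnitary_toHeckeCharacter L μ)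
            ((isOscillatorChar_toHeckeCharacter_iff μ).mpr hμ) (TW (↥(maximalRealSubfield L)) a)
            (isUnit_det_TW (↥(maximalRealSubfield L)) a) (JW (↥(maximalRealSubfield L)) L a) (JW_eq (↥(maximalRealSubfield L)) L a))
          p Φ)
  [CompactSpace (↥(UnitaryGroup.adelic (↥(maximalRealSubfield L)) L (IsCMField.complexConj L) N (Matrix.diagonal dV)) ⧸
    (UnitaryGroup.toAdelic (↥(maximalRealSubfield L)) L (IsCMField.complexConj L) N (Matrix.diagonal dV)).range)]
  [MeasurableSpace (↥(UnitaryGroup.adelic (↥(maximalRealSubfield L)) L (IsCMField.complexConj L) 1 (JW (↥(maximalRealSubfield L)) L a)) ⧸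
    (UnitaryGroup.toAdelic (↥(maximalRealSubfield L)) L (IsCMField.complexConj L) 1 (JW (↥(maximalRealSubfield L)) L a)).range)]
  (μW : Measure (↥(UnitaryGroup.adelic (↥(maximalRealSubfield L)) L (IsCMField.complexConj L) 1 (JW (↥(maximalRealSubfield L)) L a)) ⧸
    (UnitaryGroup.toAdelic (↥(maximalRealSubfield L)) L (IsCMField.complexConj L) 1 (JW (↥(maximalRealSubfield L)) L a)).range))
  (f : C((↥(UnitaryGroup.adelic (↥(maximalRealSubfield L)) L (IsCMField.complexConj L) 1 (JW (↥(maximalRealSubfield L)) L a)) ⧸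
    (UnitaryGroup.toAdelic (↥(maximalRealSubfield L)) L (IsCMField.complexConj L) 1 (JW (↥(maximalRealSubfield L)) L a)).range), ℂ))
  [BorelSpace (↥(UnitaryGroup.adelic (↥(maximalRealSubfield L)) L (IsCMField.complexConj L) 1 (JW (↥(maximalRealSubfield L)) L a)) ⧸
    (UnitaryGroup.toAdelic (↥(maximalRealSubfield L)) L (IsCMField.complexConj L) 1 (JW (↥(maximalRealSubfield L)) L a)).range)]
  [IsFiniteMeasure μW]
  [CompactSpace (adelicGroupData (↥(maximalRealSubfield L)) L (IsCMField.complexConj L) N H).automorphicQuotient]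
  (ν : Measure (adelicGroupData (↥(maximalRealSubfield L)) L (IsCMField.complexConj L) N H).automorphicQuotient)
  [(adelicGroupData (↥(maximalRealSubfield L)) L (IsCMField.complexConj L) N H).IsAutomorphicMeasure ν]
  (t : L) (ht : t ≠ 0) (g : GL (Fin N) L)
  (hg : formCongr ((IsCMField.complexConj L : L ≃ₐ[↥(maximalRealSubfield L)] L) : L →+* L) g (t • H) = Matrix.diagonal dV)
  (hpin : ∀ k, ((ιA k : ↥(UnitaryGroup.adelic (↥(maximalRealSubfield L)) L (IsCMField.complexConj L) N (Matrix.diagonal dV))) :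
      GL (Fin N) (AdeleRing (𝓞 L) L)) =
    (toAdeleGL L g)⁻¹ * adelicVal (↥(maximalRealSubfield L)) L (IsCMField.complexConj L) N H k * toAdeleGL L g)

include hιA ht hg hpin

set_option maxHeartbeats 1600000 in
/-- **(P2c) DEFINITE-PLACE TRANSITIVITY** (the `hdef` hypothesis of ★ `F0LD1ArchLadderReachability.reach_of_sameType_two` for `P β := [θ_{h_β ⊗ Φ_f}] ∈ Q`):
at a real place `v₀` of constant sign (`hconst`), for coordinates `kp ≠ km`, a closed `R`-invariant `Q`, and indices `β, γ` agreeing off `{(kp,v₀), (km,v₀)}` with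
`γ(kp,v₀) + γ(km,v₀) = β(kp,v₀) + β(km,v₀)`: `[θ_{h_β ⊗ Φ_f}] ∈ Q → [θ_{h_γ ⊗ Φ_f}] ∈ Q` — two compact steps through the merged index with the rational mixing
of the two coordinates (★ (P1)∕(P1⁻) §4, ★ S1, ★ pin, ★ `ArchPlaceFockRotationCoefficient`). [cite: Folland1989, Ch. 4 §5; Prop. (4.39)]
[cite: KashiwaraVergne1978, §6] [cite: Howe1989, §3] [cite: BrockerTomDieck1985, III (5.10)] -/
theorem thetaClass_follandHermite_mem_of_sameDegree_of_constSign (v₀ : {v : InfinitePlace (↥(maximalRealSubfield L)) // v.IsReal})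
    (hconst : (∀ k : Fin n', 0 < signVec (cmPlaceOver L) (cmGramEntry L e₁ dV hdV (lineW L (TW (Fp L) a)) (complexConj_lineW L (TW (Fp L) a))) (imagUnit L) v₀ k) ∨
      (∀ k : Fin n', ¬ 0 < signVec (cmPlaceOver L) (cmGramEntry L e₁ dV hdV (lineW L (TW (Fp L) a)) (complexConj_lineW L (TW (Fp L) a))) (imagUnit L) v₀ k))
    {kp km : Fin n'} (hk : kp ≠ km)
    (Q : ContRepresentation.ClosedSubrep ((adelicGroupData (↥(maximalRealSubfield L)) L (IsCMField.complexConj L) N H).rightRegular ν))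
    (β γ : (Fin n' × {v : InfinitePlace (↥(maximalRealSubfield L)) // v.IsReal}) →₀ ℕ) (Φf : FinSB (↥(maximalRealSubfield L)) (Fin n'))
    (hrest : ∀ s, s ≠ ((kp, v₀) : Fin n' × {v : InfinitePlace (↥(maximalRealSubfield L)) // v.IsReal}) → s ≠ (km, v₀) → γ s = β s)
    (hsum : γ (kp, v₀) + γ (km, v₀) = β (kp, v₀) + β (km, v₀))
    (hQ : MemLp.toLp _ (memLp_toQuotFun_lineThetaLift L N H e₁ dV hdV hdV0 ιA hιA μ hμ a hρ μW
            (piSchwartzBruhatEquiv (↥(maximalRealSubfield L)) (Fin n')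
              (follandHermite (frameV L e₁ dV hdV hdV0 (lineW L (TW (Fp L) a)) (complexConj_lineW L (TW (Fp L) a))
                (lineW_ne_zero L (TW (Fp L) a) (isUnit_det_TW (Fp L) a))) β ⊗ₜ Φf)) f ν 2) ∈ Q) :
    MemLp.toLp _ (memLp_toQuotFun_lineThetaLift L N H e₁ dV hdV hdV0 ιA hιA μ hμ a hρ μW
          (piSchwartzBruhatEquiv (↥(maximalRealSubfield L)) (Fin n')
            (follandHermite (frameV L e₁ dV hdV hdV0 (lineW L (TW (Fp L) a)) (complexConj_lineW L (TW (Fp L) a))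
              (lineW_ne_zero L (TW (Fp L) a) (isUnit_det_TW (Fp L) a))) γ ⊗ₜ Φf)) f ν 2) ∈ Q := by
  -- the archimedean type of the splitting character
  have hτ : (toHeckeCharacter L μ).HasUnitaryArchType hμ.infinityType 0 :=
    (hasUnitaryArchType_toHeckeCharacter_iff L μ _).2 hμ.hasInfinityType_infinityType
  have hodd : ∀ w, Odd (hμ.infinityType w) := hμ.odd_infinityType
  -- the archimedean torus hom through the pin, the Haar probability on `T_∞`, orbit continuity and unitarity of `R|_{T_∞}`
  obtain ⟨kT, hkTc, hkT, -, -⟩ := exists_continuous_archTorusHom L N H dV t ht g hg ιA hpin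
  obtain ⟨mT, bT, μT, hprob, hinv⟩ := exists_borel_haarProbability L N
  letI : MeasurableSpace (({v : InfinitePlace (↥(maximalRealSubfield L)) // v.IsReal}) → Fin N → Circle) := mT
  haveI : BorelSpace (({v : InfinitePlace (↥(maximalRealSubfield L)) // v.IsReal}) → Fin N → Circle) := bT
  haveI : IsProbabilityMeasure μT := hprob
  haveI : μT.IsMulLeftInvariant := hinv
  have hU : ∀ w, Continuous fun z : (({v : InfinitePlace (↥(maximalRealSubfield L)) // v.IsReal}) → Fin N → Circle) =>
      (((adelicGroupData (↥(maximalRealSubfield L)) L (IsCMField.complexConj L) N H).rightRegular ν).restrict kT) z w := fun w => by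
    simp only [ContRepresentation.restrict_apply]
    exact (AdelicGroupData.isStronglyContinuous_rightRegular_holds (adelicGroupData (↥(maximalRealSubfield L)) L (IsCMField.complexConj L) N H) ν w).comp hkTc
  have hUu : ∀ (z : (({v : InfinitePlace (↥(maximalRealSubfield L)) // v.IsReal}) → Fin N → Circle))
      (w w' : (adelicGroupData (↥(maximalRealSubfield L)) L (IsCMField.complexConj L) N H).L2 ν),
      ⟪(((adelicGroupData (↥(maximalRealSubfield L)) L (IsCMField.complexConj L) N H).rightRegular ν).restrict kT) z w,
        (((adelicGroupData (↥(maximalRealSubfield L)) L (IsCMField.complexConj L) N H).rightRegular ν).restrict kT) z w'⟫_ℂ = ⟪w, w'⟫_ℂ :=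
    fun z w w' => by
    rw [ContRepresentation.restrict_apply]
    exact (AdelicGroupData.isUnitary_rightRegular (adelicGroupData (↥(maximalRealSubfield L)) L (IsCMField.complexConj L) N H) ν).inner_map_map (kT z) w w'
  -- the character representations of the types of the merged index and of `γ`
  obtain ⟨κ₁, hκ₁, hκ₁irr, hκ₁u, hκ₁c⟩ := exists_charRep_prod_prod_zpow
    (fun (v : {v : InfinitePlace (↥(maximalRealSubfield L)) // v.IsReal}) (p : Fin N) =>
      (if 0 < signVec (cmPlaceOver L) (cmGramEntry L e₁ dV hdV (lineW L (TW (Fp L) a)) (complexConj_lineW L (TW (Fp L) a))) (imagUnit L) v (e₁ (p, 0))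
        then (hμ.infinityType (cmPlaceOver L v).1 + 1) / 2 +
          (merge ((kp, v₀) : Fin n' × {v : InfinitePlace (↥(maximalRealSubfield L)) // v.IsReal}) (km, v₀) β (e₁ (p, 0), v) : ℤ)
        else (hμ.infinityType (cmPlaceOver L v).1 + 1) / 2 - 1 -
          (merge ((kp, v₀) : Fin n' × {v : InfinitePlace (↥(maximalRealSubfield L)) // v.IsReal}) (km, v₀) β (e₁ (p, 0), v) : ℤ)))
  obtain ⟨κ₂, hκ₂, hκ₂irr, hκ₂u, hκ₂c⟩ := exists_charRep_prod_prod_zpow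
    (fun (v : {v : InfinitePlace (↥(maximalRealSubfield L)) // v.IsReal}) (p : Fin N) =>
      (if 0 < signVec (cmPlaceOver L) (cmGramEntry L e₁ dV hdV (lineW L (TW (Fp L) a)) (complexConj_lineW L (TW (Fp L) a))) (imagUnit L) v (e₁ (p, 0))
        then (hμ.infinityType (cmPlaceOver L v).1 + 1) / 2 + (γ (e₁ (p, 0), v) : ℤ)
        else (hμ.infinityType (cmPlaceOver L v).1 + 1) / 2 - 1 - (γ (e₁ (p, 0), v) : ℤ)))
  haveI := hκ₁irr
  haveI := hκ₂irr
  -- the two non-zero Hermite coefficients of the mixing of the coordinates `kp, km` at `v₀`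
  have hm1 := uKernel_placeBlock_mixU_merge_ne_zero v₀ hk β
  have hm2 := (uKernel_placeBlock_mixU_merge_ne_zero_and v₀ hk β γ hsum.symm (fun l h1 h2 => (hrest l h1 h2).symm)).2
  rcases hconst with hpos | hneg
  · -- positive pair form at `v₀`
    obtain ⟨u, hu⟩ := exists_archLocal_entries_eq_of_pos L e₁ dV hdV hdV0 (lineW L (TW (Fp L) a)) (complexConj_lineW L (TW (Fp L) a))
      (lineW_ne_zero L (TW (Fp L) a) (isUnit_det_TW (Fp L) a)) v₀ hpos (mixU hk)
    obtain ⟨γ₀, hγ₀, -⟩ := exists_archLocal_pin_adelicSingle_eq L N H dV t ht g hg ιA hpin (cmPlaceOver L v₀) u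
    have step1 := thetaClass_follandHermite_mem_of_uKernel_ne_zero L N H e₁ dV hdV hdV0 ιA hιA μ hμ a hρ μW f ν v₀ hτ hodd hpos u (mixU hk)
      (fun i i' => (hu i i').symm) _ hγ₀ β _ Φf hm1 kT hkT μT hκ₁ hκ₁u hκ₁c hU hUu Q hQ
    exact thetaClass_follandHermite_mem_of_uKernel_ne_zero L N H e₁ dV hdV hdV0 ιA hιA μ hμ a hρ μW f ν v₀ hτ hodd hpos u (mixU hk)
      (fun i i' => (hu i i').symm) _ hγ₀ _ γ Φf hm2 kT hkT μT hκ₂ hκ₂u hκ₂c hU hUu Q step1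
  · -- negative pair form at `v₀`
    obtain ⟨u, hu⟩ := exists_archLocal_entries_eq_of_neg L e₁ dV hdV hdV0 (lineW L (TW (Fp L) a)) (complexConj_lineW L (TW (Fp L) a))
      (lineW_ne_zero L (TW (Fp L) a) (isUnit_det_TW (Fp L) a)) v₀ hneg (mixU hk)
    obtain ⟨γ₀, hγ₀, -⟩ := exists_archLocal_pin_adelicSingle_eq L N H dV t ht g hg ιA hpin (cmPlaceOver L v₀) u
    have step1 := thetaClass_follandHermite_mem_of_uKernel_ne_zero_of_neg L N H e₁ dV hdV hdV0 ιA hιA μ hμ a hρ μW f ν v₀ hτ hodd hneg u (mixU hk)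
      (fun i i' => (hu i i').symm) _ hγ₀ β _ Φf hm1 kT hkT μT hκ₁ hκ₁u hκ₁c hU hUu Q hQ
    exact thetaClass_follandHermite_mem_of_uKernel_ne_zero_of_neg L N H e₁ dV hdV hdV0 ιA hιA μ hμ a hρ μW f ν v₀ hτ hodd hneg u (mixU hk)
      (fun i i' => (hu i i').symm) _ hγ₀ _ γ Φf hm2 kT hkT μT hκ₂ hκ₂u hκ₂c hU hUu Q step1

end Transitivity

end Summit.HodgeConjecture.HodgeConjecture.Cruxes.HLiu418.F0LD1ThetaArchDefiniteTransitivity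

end
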